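import Literature.NumberTheory.Automorphic.Zelevinsky1980.MaximalParabolicOrbitFiltration
import HarnessLib

/-!
# R90-TF · S1 «Ch10-local» · split place, ROAD β — a `W`-valued `End = ℂ` criterion for `Ind_{Q_{2,1}}^{GL₃} τ`

Cell `hodgecm-mathlib`, programme R90-TF, section S1, crux H413 (`stmt-HodgeConjecture-24833`), route `HCCMUnconditional`;
prover seat R90-C10-p02, socket S1#7 `R90.S1.SocketSplitInducedIrreducible`, ROAD β «BY SUPPORT OF σ».  THEOREMS ONLY (no `def`, no
instance, no notation, no `sorry`); ONE public theorem; lane `--supports stmt-HodgeConjecture-24833`; all characteristics.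

THE MATHEMATICS ([BernsteinZelevinskyASENS1977, Thm. 5.2 for `(Q_{2,1}, Q_{2,1})`, §7.1]; the `W`-valued form of ★
`Zelevinsky1980.exists_intertwiningMap_eq_smul`).  `P = Q_{2,1} ≤ GL₃(F)`, `τ` a smooth representation of `P` on `W` trivial on
`U_P`, `I = Ind_P^{GL₃} τ`.  For an intertwining operator `T` of `I` the functional `λ f = (T f)(1)` is `(P, τ)`-equivariant and
descends to the `U_P`-coinvariants `I_{U_P}`.  HYPOTHESIS `hkill` (the open orbit of the geometric lemma): EVERY `(P, τ)`-equivariant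
linear map `I_{U_P} → W` kills the classes of the open-cell part `I_open` — discharged by ★
`R90.S1.mk_restrictUnipotentGL_eq_zero_of_mem_vanishingOn_of_jacquet_root` when the Jacquet module of `τ` along `u₁₀(F)` vanishes
(★ `R90S1SplitInducedEndScalarOfCuspidal`), and by an exponent comparison when it is finite with regular exponent (sibling files).
Then `λ` kills every `f` vanishing on `P` (★ chart decomposition `exists_sum_smoothIndRep_swap_of_forall_toFun_eq_zero`), i.e.
`ker ev₁ ≤ ker λ`; with a Levi section `φ : G₂ → P`, `τ(φ A) = c_A σ(A)`, `σ` irreducible with Schur's lemma, the image of `ev₁`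
is `σ`-stable hence `0` or `W`, and `λ = L ∘ ev₁`, `L ∈ End(σ) = ℂ`: **every intertwining operator of `I` is a scalar.**
HONEST LABEL: a criterion (organ of S1#7), socket OPEN; HC_CM is proved only modulo the 7 printed citations (2 remaining named inputs:
hLiu418 = stmt-HodgeConjecture-24832, h413 = stmt-HodgeConjecture-24833) until rung 0 closes.
References: [BernsteinZelevinskyASENS1977] Bernstein–Zelevinsky, Ann. Sci. ÉNS 10 (1977), Thm. 5.2, §7.1 · [Casselman1995] §6.3 ·
[Zelevinsky1980] Ann. Sci. ÉNS 13 (1980), §1.1, Thm. 4.2.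
-/

set_option autoImplicit false
set_option linter.dupNamespace false

noncomputable section

open Matrix Literature.LinearAlgebra.Matrix.DiagonalTorus
open Literature.NumberTheory.Automorphic Literature.NumberTheory.Automorphic.Zelevinsky1980
open ValuativeRel

namespace Summit.HodgeConjecture.HodgeConjecture.R90.S1

variable {F : Type*} [Field F]

/-! ## §1 The Levi Weyl translates `w_i ∈ P` -/

/-- The Levi Weyl translates `w_i = (0 i)`, `i < 2`, lie in `P`. [cite: BernsteinZelevinskyASENS1977, §7.1] -/
private theorem permGL_swap_mem_standardParabolicGL' (i : Fin 2) :
    (permGL (Equiv.swap 0 (Fin.castSucc i)) : GL (Fin 3) F) ∈ standardParabolicGL F (lastBlockLabel 3) := by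
  refine permGL_mem_standardParabolicGL _ fun j => le_of_eq ?_
  have hfix : Equiv.swap (0 : Fin 3) (Fin.castSucc i) (Fin.last 2) = Fin.last 2 :=
    Equiv.swap_apply_of_ne_of_ne (Fin.last_pos'.ne') (Fin.castSucc_lt_last i).ne'
  have key : ∀ j : Fin 3, lastBlockLabel 3 j = decide (j = Fin.last 2) := by
    intro j
    simp only [lastBlockLabel, Fin.ext_iff, Fin.val_last]
    by_cases h : (j : ℕ) = 2
    · rw [decide_eq_true h, decide_eq_true (by omega)]
    · rw [decide_eq_false h, decide_eq_false (by have := j.2; omega)]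
  rw [key, key]
  congr 1
  rw [← hfix, Equiv.apply_eq_iff_eq, hfix]

variable [ValuativeRel F] [TopologicalSpace F] [IsNonarchimedeanLocalField F]

/-! ## §2 The criterion -/

/-- **`End_{GL₃}(Ind_P τ) = ℂ` when the open orbit is killed** (the `W`-valued form of ★ `Zelevinsky1980.exists_intertwiningMap_eq_smul`).
`τ` a smooth representation of `P = Q_{2,1}` on `W`, trivial on `U_P`; `σ` an irreducible representation of a group `G₂` on the same
`W` satisfying Schur's lemma, and `φ : G₂ → P` with `τ(φ A) = c_A σ(A)`, `c_A ≠ 0` (a Levi section).  If every `(P, τ)`-equivariant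
linear map `I_{U_P} → W` kills the classes of the open-cell functions (`hkill`), then every intertwining operator of `Ind_P^{GL₃} τ` is a
scalar: `λ f = (T f)(1)` descends to `I_{U_P}`, kills `I_open`, hence every `f` vanishing on `P` (★ chart decomposition), so
`λ = L ∘ ev₁` with `L ∈ End(σ) = ℂ`. [cite: BernsteinZelevinskyASENS1977, Thm. 5.2 and §7.1] -/
theorem smoothIndRep_intertwiningMap_eq_smul_of_openCell_killed
    {W : Type*} [AddCommGroup W] [Module ℂ W]
    (τ : Representation ℂ ↥(standardParabolicGL F (lastBlockLabel 3)) W)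
    (hτU : ∀ u : ↥(standardParabolicGL F (lastBlockLabel 3)), u ∈ unipotentRadicalP F (lastBlockLabel 3) → τ u = 1)
    (hkill : ∀ Λ : (Representation.restrictUnipotentGL F (lastBlockLabel 3)
        (Representation.smoothIndRep (standardParabolicGL F (lastBlockLabel 3)) τ)).Coinvariants →ₗ[ℂ] W,
      (∀ (p : ↥(standardParabolicGL F (lastBlockLabel 3)))
          (f : Representation.SmoothInd (standardParabolicGL F (lastBlockLabel 3)) τ),
          Λ (Representation.Coinvariants.mk _
            (Representation.smoothIndRep (standardParabolicGL F (lastBlockLabel 3)) τ (p : GL (Fin 3) F) f)) =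
            τ p (Λ (Representation.Coinvariants.mk _ f))) →
        ∀ f : Representation.SmoothInd (standardParabolicGL F (lastBlockLabel 3)) τ,
          f ∈ vanishingOn (standardParabolicGL F (lastBlockLabel 3)) τ (cellLT (K := F) (lastBlockLabel 3) Fin.revPerm) →
            Λ (Representation.Coinvariants.mk _ f) = 0)
    {G₂ : Type*} [Group G₂] (σ : Representation ℂ G₂ W) [σ.IsIrreducible]
    (hSchur : ∀ L : W →ₗ[ℂ] W, (∀ g : G₂, L ∘ₗ σ g = σ g ∘ₗ L) → ∃ c : ℂ, L = c • LinearMap.id)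
    (φ : G₂ → ↥(standardParabolicGL F (lastBlockLabel 3))) (cφ : G₂ → ℂ) (hcφ : ∀ A, cφ A ≠ 0)
    (hτφ : ∀ (A : G₂) (w : W), τ (φ A) w = cφ A • σ A w)
    (T : (Representation.smoothIndRep (standardParabolicGL F (lastBlockLabel 3)) τ).IntertwiningMap
      (Representation.smoothIndRep (standardParabolicGL F (lastBlockLabel 3)) τ)) :
    ∃ c : ℂ, ∀ f, T f = c • f := by
  classical
  -- the functional `λ f = (T f)(1)` and its `(P, τ)`-equivariance
  obtain ⟨lam, hlam⟩ : ∃ lam : Representation.SmoothInd (standardParabolicGL F (lastBlockLabel 3)) τ →ₗ[ℂ] W,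
      ∀ f, lam f = (T f).toFun 1 :=
    ⟨(LinearMap.proj (1 : GL (Fin 3) F)) ∘ₗ
      (Representation.SmoothInd.toFunₗ (standardParabolicGL F (lastBlockLabel 3)) τ ∘ₗ T.toLinearMap), fun f => rfl⟩
  have hT : ∀ (g : GL (Fin 3) F) (f : Representation.SmoothInd (standardParabolicGL F (lastBlockLabel 3)) τ),
      T (Representation.smoothIndRep (standardParabolicGL F (lastBlockLabel 3)) τ g f) =
        Representation.smoothIndRep (standardParabolicGL F (lastBlockLabel 3)) τ g (T f) := fun g f =>
    LinearMap.congr_fun (T.isIntertwining' g) f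
  have hTval : ∀ (g : GL (Fin 3) F) (f : Representation.SmoothInd (standardParabolicGL F (lastBlockLabel 3)) τ),
      (T f).toFun g = lam (Representation.smoothIndRep (standardParabolicGL F (lastBlockLabel 3)) τ g f) := by
    intro g f
    rw [hlam, hT, Representation.toFun_smoothIndRep_apply, one_mul]
  have hlamP : ∀ (p : ↥(standardParabolicGL F (lastBlockLabel 3)))
      (f : Representation.SmoothInd (standardParabolicGL F (lastBlockLabel 3)) τ),
      lam (Representation.smoothIndRep (standardParabolicGL F (lastBlockLabel 3)) τ (p : GL (Fin 3) F) f) = τ p (lam f) := by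
    intro p f
    rw [hlam, hlam, hT, Representation.toFun_smoothIndRep_apply, one_mul, ← mul_one (p : GL (Fin 3) F),
      Representation.SmoothInd.toFun_subgroup_mul]
  -- `λ` factors through the `U_P`-coinvariants
  have hlamU : ∀ u : ↥(unipotentRadicalP F (lastBlockLabel 3)),
      lam ∘ₗ (Representation.restrictUnipotentGL F (lastBlockLabel 3)
        (Representation.smoothIndRep (standardParabolicGL F (lastBlockLabel 3)) τ)) u = lam := by
    intro u
    ext f
    change lam (Representation.smoothIndRep (standardParabolicGL F (lastBlockLabel 3)) τ
      ((u : ↥(standardParabolicGL F (lastBlockLabel 3))) : GL (Fin 3) F) f) = lam f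
    rw [hlamP, hτU _ u.2, Module.End.one_apply]
  have hlamb : ∀ f, Representation.Coinvariants.lift _ lam hlamU (Representation.Coinvariants.mk _ f) = lam f := fun f =>
    Representation.Coinvariants.lift_mk _ _ _ _
  -- Step 1: `λ` kills the open-cell part (hypothesis `hkill` applied to the descent of `λ` to the coinvariants)
  have hopen : ∀ f : Representation.SmoothInd (standardParabolicGL F (lastBlockLabel 3)) τ,
      f ∈ vanishingOn (standardParabolicGL F (lastBlockLabel 3)) τ (cellLT (K := F) (lastBlockLabel 3) Fin.revPerm) →
        lam f = 0 := by
    intro f hf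
    rw [← hlamb]
    exact hkill _ (fun p g => by rw [hlamb, hlamb, hlamP]) f hf
  -- Step 2: `λ` kills every `f` vanishing on `P` (chart decomposition), i.e. `ker ev₁ ≤ ker λ`
  have hclosed : ∀ f : Representation.SmoothInd (standardParabolicGL F (lastBlockLabel 3)) τ,
      (∀ p ∈ standardParabolicGL F (lastBlockLabel 3), f.toFun p = 0) → lam f = 0 := by
    intro f hf
    obtain ⟨fi, hfi, hsum⟩ := exists_sum_smoothIndRep_swap_of_forall_toFun_eq_zero τ f hf
    rw [hsum, map_sum]
    refine Finset.sum_eq_zero fun i _ => ?_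
    rw [hlamP ⟨_, permGL_swap_mem_standardParabolicGL' i⟩, hopen _ (hfi i), map_zero]
  have hker : ∀ f : Representation.SmoothInd (standardParabolicGL F (lastBlockLabel 3)) τ, f.toFun 1 = 0 → lam f = 0 := by
    intro f h0
    refine hclosed f fun p hp => ?_
    rw [← mul_one p, show p * 1 = ((⟨p, hp⟩ : ↥(standardParabolicGL F (lastBlockLabel 3))) : GL (Fin 3) F) * 1 from rfl,
      Representation.SmoothInd.toFun_subgroup_mul, h0, map_zero]
  -- Step 3: `λ = c · ev₁`
  have hev : ∃ c : ℂ, ∀ f : Representation.SmoothInd (standardParabolicGL F (lastBlockLabel 3)) τ, lam f = c • f.toFun 1 := by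
    by_cases hex : ∃ f₁ : Representation.SmoothInd (standardParabolicGL F (lastBlockLabel 3)) τ, f₁.toFun 1 ≠ 0
    · -- `ev₁` is surjective: its image is a non-zero `σ`-stable subspace of the irreducible `σ`
      obtain ⟨ev, hev⟩ : ∃ ev : Representation.SmoothInd (standardParabolicGL F (lastBlockLabel 3)) τ →ₗ[ℂ] W,
          ∀ f, ev f = f.toFun 1 :=
        ⟨(LinearMap.proj (1 : GL (Fin 3) F)) ∘ₗ Representation.SmoothInd.toFunₗ (standardParabolicGL F (lastBlockLabel 3)) τ,
          fun f => rfl⟩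
      have hevA : ∀ (A : G₂) (f : Representation.SmoothInd (standardParabolicGL F (lastBlockLabel 3)) τ),
          ev (Representation.smoothIndRep (standardParabolicGL F (lastBlockLabel 3)) τ ((φ A : ↥(standardParabolicGL F
            (lastBlockLabel 3))) : GL (Fin 3) F) f) = cφ A • σ A (ev f) := by
        intro A f
        rw [hev, hev, Representation.toFun_smoothIndRep_apply, one_mul,
          ← mul_one ((φ A : ↥(standardParabolicGL F (lastBlockLabel 3))) : GL (Fin 3) F),
          Representation.SmoothInd.toFun_subgroup_mul, hτφ]
      have hσev : ∀ (A : G₂) (f : Representation.SmoothInd (standardParabolicGL F (lastBlockLabel 3)) τ),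
          σ A (ev f) = (cφ A)⁻¹ • ev (Representation.smoothIndRep (standardParabolicGL F (lastBlockLabel 3)) τ
            ((φ A : ↥(standardParabolicGL F (lastBlockLabel 3))) : GL (Fin 3) F) f) := by
        intro A f
        rw [hevA, smul_smul, inv_mul_cancel₀ (hcφ A), one_smul]
      let R : Subrepresentation σ :=
        ⟨LinearMap.range ev, fun A w hw => by
          obtain ⟨f, rfl⟩ := hw
          rw [hσev]
          exact Submodule.smul_mem _ _ (LinearMap.mem_range_self ev _)⟩
      have hR : R = ⊤ := by
        rcases IsSimpleOrder.eq_bot_or_eq_top R with h | h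
        · exfalso
          obtain ⟨f₁, hf₁⟩ := hex
          have hmem : ev f₁ ∈ R.toSubmodule := LinearMap.mem_range_self ev f₁
          rw [h] at hmem
          change ev f₁ ∈ (⊥ : Submodule ℂ W) at hmem
          rw [hev] at hmem
          exact hf₁ ((Submodule.mem_bot ℂ).1 hmem)
        · exact h
      have hsurj : Function.Surjective ev := by
        intro w
        have hw : w ∈ R.toSubmodule := by
          rw [hR]
          change w ∈ (⊤ : Submodule ℂ W)
          exact Submodule.mem_top
        exact hw
      -- `λ = L ∘ ev₁` for a linear `L : W → W`
      have hkerle : LinearMap.ker ev ≤ LinearMap.ker lam := fun f hf => by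
        rw [LinearMap.mem_ker] at hf ⊢
        rw [hev] at hf
        exact hker f hf
      obtain ⟨L, hL⟩ : ∃ L : W →ₗ[ℂ] W, ∀ f, L (ev f) = lam f := by
        refine ⟨((LinearMap.ker ev).liftQ lam hkerle) ∘ₗ (ev.quotKerEquivOfSurjective hsurj).symm.toLinearMap, fun f => ?_⟩
        change (LinearMap.ker ev).liftQ lam hkerle ((ev.quotKerEquivOfSurjective hsurj).symm (ev f)) = lam f
        rw [← LinearMap.quotKerEquivOfSurjective_apply_mk ev hsurj f, LinearEquiv.symm_apply_apply]
        exact Submodule.liftQ_apply _ _ _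
      have hLσ : ∀ A : G₂, L ∘ₗ σ A = σ A ∘ₗ L := by
        intro A
        refine LinearMap.ext fun w => ?_
        obtain ⟨f, rfl⟩ := hsurj w
        rw [LinearMap.comp_apply, LinearMap.comp_apply, hσev, map_smul, hL, hL, hlamP, hτφ, smul_smul,
          inv_mul_cancel₀ (hcφ A), one_smul]
      obtain ⟨c, hc⟩ := hSchur L hLσ
      refine ⟨c, fun f => ?_⟩
      rw [← hev, ← hL, hc, LinearMap.smul_apply, LinearMap.id_apply]
    · refine ⟨0, fun f => ?_⟩
      rw [zero_smul]
      refine hker f ?_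
      by_contra h
      exact hex ⟨f, h⟩
  obtain ⟨c, hc⟩ := hev
  refine ⟨c, fun f => Representation.SmoothInd.ext (funext fun g => ?_)⟩
  rw [hTval, hc, Representation.toFun_smoothIndRep_apply, one_mul, Representation.SmoothInd.toFun_smul, Pi.smul_apply]

end Summit.HodgeConjecture.HodgeConjecture.R90.S1

end
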